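import Literature.NumberTheory.LFunctions.EntireZeroSumWeight
import Literature.NumberTheory.LFunctions.ZeroSumDyadic
import Literature.NumberTheory.LFunctions.DedekindZeta1LogFreeTheorem14
import Literature.NumberTheory.LFunctions.DedekindZetaExplicitFormula
import Literature.NumberTheory.LFunctions.ImaginaryQuadraticResidueBound
import HarnessLib

/-!
# The sum over the zeros of all class group `L`-functions against the Thorner–Zaman weight

Topic `Literature/NumberTheory/LFunctions`, namespace `Literature.NumberTheory.LFunctions.NumberField`.
Everything here is PROVED; `famF`, `famMult`, `excRegion` are glue definitions.

For an imaginary quadratic field `K` the family `F_ψ` (`ψ ∈ Ĉl_K`): `F_0 = ζ₁_K`, `F_ψ = L₀(·, χ_ψ)`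
(`ψ ≠ 0`). This file assembles, uniformly in `K`, Thorner–Zaman's (2019) §4.3 estimate for the zero
terms of the explicit formulae of the whole family against the weight `tzTest L ε`:

* `famF`, `famMult` (multiplicities), the window bounds of every member (`fam_window`);
* `excRegion c K ρ` — the real segment `Im ρ = 0`, `Re ρ > 1 − c/(log|d_K| + log 4)` of the
  Landau–Page package, and `re_le_of_not_excRegion` — off it every zero obeys the classical
  zero-free region `β ≤ 1 − c/(log|d_K| + log(|γ| + 4))` (`exists_exceptionalZero_const`);
* `fam_density` — the log-free zero-density bound for the pairs `(ψ, ρ)` with `|γ| ≤ T`, `β ≥ 1/4`,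
  in the shape `≤ D_K e^{b(𝓠 + log(T + 4))(1−α)}`, `𝓠 = 2 log Q`, `Q = 4|d_K|`, from
  `logFreeDensity_classGroup` and `logFreeDensity_dedekindZeta₁` at `P = Q²(T + 2)`
  (`h_K ≤ d_K²`, `κ_K ≥ 1/Q`).

The final inequality for the family (zero terms `≤ A x·errorTerm + junk`) is assembled from these,
`EntireEF.sum_zeroTerm_le` and `LinnikZeroSum.sum_rpow_div_le_of_density_zfr` in the sequel file.

## References

* J. Thorner, A. Zaman, ANT 13 (2019), §4.3 (Lemmas 4.4–4.6). [ThornerZaman2019]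
-/

noncomputable section

open Complex Real MeasureTheory Set Filter Topology
open scoped NumberField nonZeroDivisors

namespace Literature.NumberTheory.LFunctions.NumberField

open Literature.NumberTheory.LFunctions.EntireEF Literature.NumberTheory.LFunctions.LogFreeDensity
  Literature.NumberTheory.LFunctions.LogFreeLocal Literature.NumberTheory.LFunctions.AbelianDensity

variable {K : Type} [Field K] [NumberField K]

/-! ### The family -/

/-- The family of entire functions attached to `Ĉl_K`: `F_0 = ζ₁_K`, `F_ψ = L₀(·, χ_ψ)` (`ψ ≠ 0`).
[cite: ThornerZaman2019, §2.3] -/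
def famF (K : Type) [Field K] [NumberField K] (ψ : AddChar (Additive (ClassGroup (𝓞 K))) ℂ) : ℂ → ℂ :=
  if ψ = 0 then dedekindZeta₁ K else classGroupLFunction₀ K (toMulHom ψ).toHomUnits

/-- The multiplicity of `ρ` as a zero of `F_ψ` (`0` if `F_ψ(ρ) ≠ 0`). [folklore] -/
def famMult (K : Type) [Field K] [NumberField K] (ψ : AddChar (Additive (ClassGroup (𝓞 K))) ℂ) (ρ : ℂ) : ℕ :=
  analyticOrderNatAt (famF K ψ) ρ

omit [NumberField K] in
/-- `F_0 = ζ₁_K`. [folklore] -/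
theorem famF_zero [NumberField K] : famF K 0 = dedekindZeta₁ K := by simp [famF]

/-- `F_ψ = L₀(·, χ_ψ)` for `ψ ≠ 0`. [folklore] -/
theorem famF_of_ne {ψ : AddChar (Additive (ClassGroup (𝓞 K))) ℂ} (hψ : ψ ≠ 0) :
    famF K ψ = classGroupLFunction₀ K (toMulHom ψ).toHomUnits := by simp [famF, hψ]

/-- Every member is entire. [folklore] -/
theorem differentiable_famF (ψ : AddChar (Additive (ClassGroup (𝓞 K))) ℂ) : Differentiable ℂ (famF K ψ) := by
  by_cases hψ : ψ = 0
  · subst hψ; rw [famF_zero]; exact dedekindZeta₁_differentiable K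
  · rw [famF_of_ne hψ]; exact differentiable_classGroupLFunction₀ _

/-- Every member is non-zero at `2`. [folklore] -/
theorem famF_two_ne_zero (ψ : AddChar (Additive (ClassGroup (𝓞 K))) ℂ) : famF K ψ 2 ≠ 0 := by
  by_cases hψ : ψ = 0
  · subst hψ; rw [famF_zero]; exact dedekindZeta₁_ne_zero_of_one_le_re (by norm_num)
  · rw [famF_of_ne hψ]
    have := classGroupLFunction₀_two_add_ne_zero (toHomUnits_ne_one hψ) 0
    simpa using this

/-- **The window bound of every member**: `Σ_{window} m ≤ 512(n+1) (log|d_K| + 3n + log(|τ| + 4))`. [folklore] -/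
theorem fam_window (ψ : AddChar (Additive (ClassGroup (𝓞 K))) ℂ) (τ : ℝ) (P : Finset ℂ)
    (hP : ∀ ρ ∈ P, famF K ψ ρ = 0 ∧ 0 < ρ.re ∧ ρ.re < 1 ∧ |ρ.im - τ| ≤ 1 / 2) :
    ∑ ρ ∈ P, (analyticOrderNatAt (famF K ψ) ρ : ℝ) ≤
      (512 * (Module.finrank ℚ K + 1)) * ((Real.log ((NumberField.discr K).natAbs : ℝ) + 3 * Module.finrank ℚ K) + Real.log (|τ| + 4)) := by
  by_cases hψ : ψ = 0
  · subst hψ; rw [famF_zero] at hP ⊢; exact window_bound_dedekindZeta₁ τ P hP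
  · rw [famF_of_ne hψ] at hP ⊢; exact window_bound_classGroupLFunction₀ (toHomUnits_ne_one hψ) τ P hP

/-! ### The exceptional segment and the zero-free region off it -/

/-- The real segment of the Landau–Page package: `Im ρ = 0` and `Re ρ > 1 − c/(log|d_K| + log 4)`.
[cite: ThornerZaman2019, Theorem 3.1] -/
def excRegion (c : ℝ) (K : Type) [Field K] [NumberField K] (ρ : ℂ) : Prop :=
  ρ.im = 0 ∧ 1 - c / (Real.log ((NumberField.discr K).natAbs : ℝ) + Real.log 4) < ρ.re

/-- Classical decidability of the exceptional segment (for `Finset.filter`). [folklore] -/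
instance (c : ℝ) (K : Type) [Field K] [NumberField K] : DecidablePred (excRegion c K) :=
  fun _ ↦ Classical.propDecidable _

/-- **Off the exceptional segment every zero of the family obeys the classical zero-free region**:
with the constant `c = c(n)` of `exists_exceptionalZero_const`, a zero `ρ` of `F_ψ` with
`¬ excRegion c K ρ` has `Re ρ ≤ 1 − c/(log|d_K| + log(|Im ρ| + 4))` (clause (1) of the package: zeros
in the region are real). [cite: ThornerZaman2019, Theorem 3.1] -/
theorem re_le_of_not_excRegion {c : ℝ}
    (hpack : ∀ (χ : ClassGroup (𝓞 K) →* ℂˣ) (ρ : ℂ),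
      (((χ = 1 → dedekindZeta₁ K ρ = 0) ∧ (χ ≠ 1 → classGroupLFunction₀ K χ ρ = 0)) ∧
        1 - c / (Real.log ((NumberField.discr K).natAbs : ℝ) + Real.log (|ρ.im| + 4)) < ρ.re) → ρ.im = 0 ∧ χ * χ = 1)
    (ψ : AddChar (Additive (ClassGroup (𝓞 K))) ℂ) {ρ : ℂ} (h0 : famF K ψ ρ = 0) (hexc : ¬ excRegion c K ρ) :
    ρ.re ≤ 1 - c / (Real.log ((NumberField.discr K).natAbs : ℝ) + Real.log (|ρ.im| + 4)) := by
  by_contra hgt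
  rw [not_le] at hgt
  have hZ : ((((toMulHom ψ).toHomUnits = 1 → dedekindZeta₁ K ρ = 0) ∧
      ((toMulHom ψ).toHomUnits ≠ 1 → classGroupLFunction₀ K (toMulHom ψ).toHomUnits ρ = 0)) ∧
      1 - c / (Real.log ((NumberField.discr K).natAbs : ℝ) + Real.log (|ρ.im| + 4)) < ρ.re) := by
    refine ⟨⟨fun h1 ↦ ?_, fun h1 ↦ ?_⟩, hgt⟩
    · have hψ : ψ = 0 := by
        by_contra hψ; exact toHomUnits_ne_one hψ h1
      subst hψ; rwa [famF_zero] at h0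
    · have hψ : ψ ≠ 0 := fun h ↦ h1 (by rw [h]; exact toHomUnits_toMulHom_zero)
      rwa [famF_of_ne hψ] at h0
  obtain ⟨him, -⟩ := hpack _ ρ hZ
  apply hexc
  refine ⟨him, ?_⟩
  rw [him, abs_zero, zero_add] at hgt
  exact hgt


/-! ### The log-free density bound for the pairs `(ψ, ρ)` -/

/-- `zeroOrder = analyticOrderNatAt` (the tree's name in `LogFreeLocal`). [folklore] -/
theorem zeroOrder_eq_famMult (ψ : AddChar (Additive (ClassGroup (𝓞 K))) ℂ) (ρ : ℂ) :
    zeroOrder (famF K ψ) ρ = famMult K ψ ρ := rfl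

/-- **Log-free zero density for the family of an imaginary quadratic field**, in the shape used by
`LinnikZeroSum.sum_rpow_div_le_of_density_zfr`: there are `b, D > 0` (absolute) such that for every
imaginary quadratic `K`, every `T ≥ 1`, every `α ≤ 1` and all finite sets `u ψ` of zeros of `F_ψ`
with `1/4 ≤ β < 1`, `|γ| ≤ T`:
`Σ_ψ Σ_{ρ ∈ u ψ, α ≤ β} m_ψ(ρ) ≤ D · e^{b(𝓠 + log(T + 4))(1 − α)}`, `𝓠 = 2 log Q`, `Q = 4|d_K|`
(`logFreeDensity_classGroup` + `logFreeDensity_dedekindZeta₁` at `P = Q²(T + 2)`, with `|d_K| ≤ P`,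
`h_K ≤ d_K² ≤ P`, `P⁻¹ ≤ Q⁻¹ ≤ κ_K`). [cite: ThornerZaman2019, Theorem 3.2] -/
theorem fam_density : ∃ b D : ℝ, 0 < b ∧ 0 < D ∧
    ∀ (K : Type) [Field K] [NumberField K], Module.finrank ℚ K = 2 → NumberField.IsTotallyComplex K →
      ∀ (T : ℝ), 1 ≤ T → ∀ u : AddChar (Additive (ClassGroup (𝓞 K))) ℂ → Finset ℂ,
        (∀ ψ, ∀ ρ ∈ u ψ, famF K ψ ρ = 0 ∧ 1 / 4 ≤ ρ.re ∧ ρ.re < 1 ∧ |ρ.im| ≤ T) →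
        ∀ α : ℝ, α ≤ 1 →
          ∑ ψ, ∑ ρ ∈ u ψ with α ≤ ρ.re, (famMult K ψ ρ : ℝ) ≤
            D * Real.exp (b * (2 * Real.log (ThornerZaman.condQ K) + Real.log (T + 4))) ^ (1 - α) := by
  classical
  obtain ⟨c₁, C₁, hc₁, hC₁, hCG⟩ := logFreeDensity_classGroup 2 (by norm_num)
  obtain ⟨c₂, C₂, hc₂, hC₂, hZ1⟩ := logFreeDensity_dedekindZeta₁ 2 le_rfl
  refine ⟨max c₁ c₂, C₁ + C₂, by positivity, by positivity, fun K _ _ h2 htc T hT u hu α hα1 ↦ ?_⟩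
  have hd : NumberField.discr K < 0 := discr_neg_of_isTotallyComplex h2 htc
  set Q : ℝ := ThornerZaman.condQ K with hQ
  have hQ12 : (12 : ℝ) ≤ Q := ThornerZaman.twelve_le_condQ (K := K) (by rw [h2]; norm_num)
  set P : ℝ := Q ^ 2 * (T + 2) with hP
  have hQ1 : (1 : ℝ) ≤ Q := by linarith
  have hP2 : (2 : ℝ) ≤ P := by
    have : (1 : ℝ) ≤ Q ^ 2 := one_le_pow₀ hQ1
    rw [hP]; nlinarith
  have hdP : ((NumberField.discr K).natAbs : ℝ) ≤ P := by
    have h1 : ((NumberField.discr K).natAbs : ℝ) ≤ Q := by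
      rw [hQ, ThornerZaman.condQ, Nat.cast_natAbs, Int.cast_abs]
      linarith [abs_nonneg ((NumberField.discr K : ℝ))]
    have h2' : Q ≤ P := by
      rw [hP]; have : (1 : ℝ) ≤ Q := hQ1; nlinarith
    linarith
  have hhP : (Fintype.card (ClassGroup (𝓞 K)) : ℝ) ≤ P := by
    have h1 : (NumberField.classNumber K : ℝ) ≤ (NumberField.discr K : ℝ) ^ 2 := classNumber_le_discr_sq h2 htc
    have h2' : (NumberField.discr K : ℝ) ^ 2 ≤ Q ^ 2 := by
      rw [hQ, ThornerZaman.condQ, ← sq_abs]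
      exact pow_le_pow_left₀ (abs_nonneg _) (by linarith [abs_nonneg ((NumberField.discr K : ℝ))]) 2
    have h3 : Q ^ 2 ≤ P := by rw [hP]; nlinarith [sq_nonneg Q]
    rw [show (Fintype.card (ClassGroup (𝓞 K)) : ℝ) = (NumberField.classNumber K : ℝ) from rfl]
    linarith
  have hκP : P⁻¹ ≤ NumberField.dedekindZeta_residue K := by
    refine le_trans ?_ (condQ_inv_le_dedekindZeta_residue h2 hd)
    rw [← hQ]
    exact inv_anti₀ (by linarith) (by rw [hP]; nlinarith [sq_nonneg Q])
  have hTP : T ≤ P := by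
    rw [hP]; have : (1 : ℝ) ≤ Q ^ 2 := one_le_pow₀ hQ1; nlinarith
  -- clamp `α` at `0`
  set α' : ℝ := max α 0 with hα'
  have hα'0 : 0 ≤ α' := le_max_right _ _
  have hα'1 : α' ≤ 1 := max_le hα1 zero_le_one
  have hfilter : ∀ ψ, (u ψ).filter (fun ρ ↦ α ≤ ρ.re) = (u ψ).filter (fun ρ ↦ α' ≤ ρ.re) := by
    intro ψ
    refine Finset.filter_congr fun ρ hρ ↦ ?_
    have := (hu ψ ρ hρ).2.1
    rw [hα', max_le_iff]
    exact ⟨fun h ↦ ⟨h, by linarith⟩, fun h ↦ h.1⟩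
  simp_rw [hfilter]
  -- the `χ ≠ 1` part
  set Z : (ClassGroup (𝓞 K) →* ℂˣ) → Finset ℂ := fun χ ↦
    (Finset.univ.filter fun ψ : AddChar (Additive (ClassGroup (𝓞 K))) ℂ ↦ (toMulHom ψ).toHomUnits = χ).biUnion u with hZdef
  have hZψ : ∀ ψ, Z (toMulHom ψ).toHomUnits = u ψ := by
    intro ψ
    rw [hZdef]; dsimp only
    have : (Finset.univ.filter fun ψ' : AddChar (Additive (ClassGroup (𝓞 K))) ℂ ↦ (toMulHom ψ').toHomUnits = (toMulHom ψ).toHomUnits) = {ψ} := by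
      ext ψ'
      simp only [Finset.mem_filter, Finset.mem_univ, true_and, Finset.mem_singleton]
      exact ⟨fun h ↦ toHomUnits_toMulHom_injective h, fun h ↦ by rw [h]⟩
    rw [this, Finset.singleton_biUnion]
  have hline : ∀ χ : ClassGroup (𝓞 K) →* ℂˣ, χ ≠ 1 → ∀ ρ : ℂ, classGroupLFunction₀ K χ ρ = 0 → ρ.re < 1 := by
    intro χ hχ ρ h0
    by_contra h1; rw [not_lt] at h1
    exact classGroupLFunction₀_ne_zero_of_one_le_re hχ h1 h0
  have hZ : ∀ χ : ClassGroup (𝓞 K) →* ℂˣ, χ ≠ 1 → ∀ ρ ∈ Z χ,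
      classGroupLFunction₀ K χ ρ = 0 ∧ 1 / 4 ≤ ρ.re ∧ ρ.re < 1 ∧ |ρ.im| ≤ P := by
    intro χ hχ ρ hρ
    rw [hZdef] at hρ; dsimp only at hρ
    rw [Finset.mem_biUnion] at hρ
    obtain ⟨ψ, hψ, hρu⟩ := hρ
    rw [Finset.mem_filter] at hψ
    have hψ0 : ψ ≠ 0 := by
      rintro rfl; rw [toHomUnits_toMulHom_zero] at hψ; exact hχ hψ.2.symm
    obtain ⟨h0, h14, h1, hT'⟩ := hu ψ ρ hρu
    rw [famF_of_ne hψ0, hψ.2] at h0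
    exact ⟨h0, h14, h1, hT'.trans hTP⟩
  have hA := hCG K h2 hline P hP2 hdP hhP hκP Z hZ α' hα'0 hα'1
  -- the `ζ_K` part
  have hZ0 : ∀ ρ ∈ u 0, dedekindZeta₁ K ρ = 0 ∧ 1 / 4 ≤ ρ.re ∧ ρ.re < 1 ∧ |ρ.im| ≤ P := by
    intro ρ hρ
    obtain ⟨h0, h14, h1, hT'⟩ := hu 0 ρ hρ
    rw [famF_zero] at h0
    exact ⟨h0, h14, h1, hT'.trans hTP⟩
  have hB := hZ1 K h2 P hP2 hdP hhP hκP (u 0) hZ0 α' hα'0 hα'1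
  -- assemble: split `Σ_ψ` into `ψ = 0` and `ψ ≠ 0`
  rw [← Finset.sum_filter_add_sum_filter_not Finset.univ (fun ψ ↦ ψ = (0 : AddChar (Additive (ClassGroup (𝓞 K))) ℂ))]
  rw [Finset.filter_eq' Finset.univ (0 : AddChar (Additive (ClassGroup (𝓞 K))) ℂ), if_pos (Finset.mem_univ _),
    Finset.sum_singleton]
  have hA' : ∑ ψ ∈ Finset.univ.filter (fun ψ ↦ ¬ ψ = (0 : AddChar (Additive (ClassGroup (𝓞 K))) ℂ)),
      ∑ ρ ∈ (u ψ).filter (fun ρ ↦ α' ≤ ρ.re), (famMult K ψ ρ : ℝ) ≤ C₁ * P ^ (c₁ * (1 - α')) := by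
    refine le_of_eq_of_le ?_ hA
    refine Finset.sum_congr rfl fun ψ hψ ↦ ?_
    rw [Finset.mem_filter] at hψ
    rw [hZψ]
    refine Finset.sum_congr rfl fun ρ _ ↦ ?_
    rw [famMult, famF_of_ne hψ.2]; rfl
  have hB' : ∑ ρ ∈ (u 0).filter (fun ρ ↦ α' ≤ ρ.re), (famMult K 0 ρ : ℝ) ≤ C₂ * P ^ (c₂ * (1 - α')) := by
    refine le_of_eq_of_le (Finset.sum_congr rfl fun ρ _ ↦ ?_) hB
    rw [famMult, famF_zero]; rfl
  -- `P^{c(1-α')} ≤ exp(b(𝓠 + log(T+4)))^{1-α}`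
  set B : ℝ := Real.exp (max c₁ c₂ * (2 * Real.log Q + Real.log (T + 4))) with hBdef
  have hP1 : (1 : ℝ) ≤ P := by linarith
  have hPexp : P ≤ Real.exp (2 * Real.log Q + Real.log (T + 4)) := by
    rw [Real.exp_add, Real.exp_log (by linarith), show 2 * Real.log Q = Real.log (Q ^ 2) by
      rw [Real.log_pow]; norm_num, Real.exp_log (by positivity), hP]
    nlinarith [sq_nonneg Q]
  have hpow : ∀ {c : ℝ}, 0 < c → c ≤ max c₁ c₂ → P ^ (c * (1 - α')) ≤ B ^ (1 - α) := by
    intro c hc hcm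
    have h1α : 0 ≤ 1 - α' := by linarith
    have hαα : 1 - α' ≤ 1 - α := by rw [hα']; exact sub_le_sub_left (le_max_left _ _) _
    have hB1 : 1 ≤ B := Real.one_le_exp (by
      have : 0 ≤ Real.log Q := Real.log_nonneg hQ1
      have : 0 ≤ Real.log (T + 4) := Real.log_nonneg (by linarith)
      positivity)
    calc P ^ (c * (1 - α')) = (P ^ c) ^ (1 - α') := by rw [Real.rpow_mul (by linarith)]
      _ ≤ (Real.exp (2 * Real.log Q + Real.log (T + 4)) ^ (max c₁ c₂)) ^ (1 - α') := by
          refine Real.rpow_le_rpow (by positivity) ?_ h1α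
          have hE1 : 1 ≤ Real.exp (2 * Real.log Q + Real.log (T + 4)) := by linarith
          exact (Real.rpow_le_rpow (by linarith) hPexp hc.le).trans (Real.rpow_le_rpow_of_exponent_le hE1 hcm)
      _ = B ^ (1 - α') := by
          rw [hBdef, ← Real.exp_mul]; ring_nf
      _ ≤ B ^ (1 - α) := Real.rpow_le_rpow_of_exponent_le hB1 hαα
  have h1 := hpow hc₁ (le_max_left _ _)
  have h2' := hpow hc₂ (le_max_right _ _)
  have hBpos : 0 ≤ B ^ (1 - α) := Real.rpow_nonneg (Real.exp_pos _).le _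
  calc ∑ ρ ∈ (u 0).filter (fun ρ ↦ α' ≤ ρ.re), (famMult K 0 ρ : ℝ) +
        ∑ ψ ∈ Finset.univ.filter (fun ψ ↦ ¬ ψ = (0 : AddChar (Additive (ClassGroup (𝓞 K))) ℂ)),
          ∑ ρ ∈ (u ψ).filter (fun ρ ↦ α' ≤ ρ.re), (famMult K ψ ρ : ℝ)
      ≤ C₂ * P ^ (c₂ * (1 - α')) + C₁ * P ^ (c₁ * (1 - α')) := add_le_add hB' hA'
    _ ≤ C₂ * B ^ (1 - α) + C₁ * B ^ (1 - α) := add_le_add (mul_le_mul_of_nonneg_left h2' hC₂.le) (mul_le_mul_of_nonneg_left h1 hC₁.le)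
    _ = (C₁ + C₂) * B ^ (1 - α) := by ring


/-! ### Counting zeros up to height `T` from the window bound -/

/-- **`Σ_{|γ| ≤ T} m(ρ) ≤ (2T + 3) W (A + log(T + 5))`** for a finite set of zeros in the strip with
`|γ| ≤ T` (`T ≥ 0`), from a window bound `(W, A)` (fibres of `round γ`). [folklore] -/
theorem sum_mult_le_of_window {f : ℂ → ℂ} {W A : ℝ} (hW : 0 ≤ W) (hA : 0 ≤ A)
    (hwin : ∀ (τ : ℝ) (P : Finset ℂ), (∀ ρ ∈ P, f ρ = 0 ∧ 0 < ρ.re ∧ ρ.re < 1 ∧ |ρ.im - τ| ≤ 1 / 2) →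
      ∑ ρ ∈ P, (analyticOrderNatAt f ρ : ℝ) ≤ W * (A + Real.log (|τ| + 4)))
    {T : ℝ} (hT : 0 ≤ T) (P : Finset ℂ) (hP : ∀ ρ ∈ P, f ρ = 0 ∧ 0 < ρ.re ∧ ρ.re < 1 ∧ |ρ.im| ≤ T) :
    ∑ ρ ∈ P, (analyticOrderNatAt f ρ : ℝ) ≤ (2 * T + 3) * (W * (A + Real.log (T + 5))) := by
  classical
  set kf : ℂ → ℤ := fun ρ ↦ round ρ.im with hkf
  rw [← Finset.sum_fiberwise_of_maps_to (g := kf) (fun ρ _ ↦ Finset.mem_image_of_mem kf ‹_›)]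
  -- each fibre is in the window at `k`, `|k| ≤ T + 1/2`
  have hfib : ∀ k ∈ P.image kf, ∑ ρ ∈ P with kf ρ = k, (analyticOrderNatAt f ρ : ℝ) ≤ W * (A + Real.log (T + 5)) := by
    intro k hk
    obtain ⟨ρ₀, hρ₀, hk₀⟩ := Finset.mem_image.1 hk
    have hkT : |(k : ℝ)| ≤ T + 1 := by
      have h1 := abs_sub_round ρ₀.im
      rw [← hk₀, hkf]
      have := (hP ρ₀ hρ₀).2.2.2
      have h2 : |(round ρ₀.im : ℝ)| ≤ |ρ₀.im| + |ρ₀.im - round ρ₀.im| := by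
        have := abs_sub_abs_le_abs_sub (round ρ₀.im : ℝ) ρ₀.im
        rw [abs_sub_comm] at this; linarith
      linarith
    refine (hwin k _ fun ρ hρ ↦ ?_).trans ?_
    · rw [Finset.mem_filter] at hρ
      obtain ⟨h0, h1, h2, -⟩ := hP ρ hρ.1
      refine ⟨h0, h1, h2, ?_⟩
      rw [← hρ.2, hkf]; exact abs_sub_round ρ.im
    · refine mul_le_mul_of_nonneg_left ?_ hW
      have := Real.log_le_log (by linarith [abs_nonneg (k : ℝ)]) (by linarith : |(k : ℝ)| + 4 ≤ T + 5)
      linarith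
  refine (Finset.sum_le_sum hfib).trans ?_
  rw [Finset.sum_const, nsmul_eq_mul]
  refine mul_le_mul_of_nonneg_right ?_ (by
    have : 0 ≤ Real.log (T + 5) := Real.log_nonneg (by linarith)
    positivity)
  -- `#image ≤ #(Icc (-N) N) = 2N + 1`, `N = ⌊T + 1⌋`
  set N : ℕ := ⌊T + 1⌋₊ with hN
  have hsub : P.image kf ⊆ Finset.Icc (-(N : ℤ)) N := by
    intro k hk
    obtain ⟨ρ₀, hρ₀, hk₀⟩ := Finset.mem_image.1 hk
    have hkT : |(k : ℝ)| ≤ T + 1 := by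
      have h1 := abs_sub_round ρ₀.im
      rw [← hk₀, hkf]
      have := (hP ρ₀ hρ₀).2.2.2
      have h2 : |(round ρ₀.im : ℝ)| ≤ |ρ₀.im| + |ρ₀.im - round ρ₀.im| := by
        have := abs_sub_abs_le_abs_sub (round ρ₀.im : ℝ) ρ₀.im
        rw [abs_sub_comm] at this; linarith
      linarith
    have hkN : |k| ≤ (N : ℤ) := by
      have hNT : T + 1 < (N : ℝ) + 1 := by rw [hN]; exact Nat.lt_floor_add_one _
      have h1 : |(k : ℝ)| < (N : ℝ) + 1 := lt_of_le_of_lt hkT hNT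
      have h2 : ((|k| : ℤ) : ℝ) < ((N + 1 : ℤ) : ℝ) := by
        rw [Int.cast_abs]; push_cast; exact h1
      have h3 : |k| < (N : ℤ) + 1 := by exact_mod_cast h2
      omega
    rw [Finset.mem_Icc]; exact abs_le.1 hkN
  calc ((P.image kf).card : ℝ) ≤ ((Finset.Icc (-(N : ℤ)) N).card : ℝ) := by exact_mod_cast Finset.card_le_card hsub
    _ = 2 * (N : ℝ) + 1 := by
        rw [Int.card_Icc]
        have : ((N : ℤ) + 1 - -(N : ℤ)).toNat = 2 * N + 1 := by omega
        rw [this]; push_cast; ring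
    _ ≤ 2 * T + 3 := by
        have : (N : ℝ) ≤ T + 1 := Nat.floor_le (by linarith)
        linarith


/-! ### The finite part: dyadic blocks, density and the zero-free region -/

/-- The truncated zero set of `F_ψ` (`|γ| ≤ T`), a `Finset`. [folklore] -/
def famFin (K : Type) [Field K] [NumberField K] (ψ : AddChar (Additive (ClassGroup (𝓞 K))) ℂ) (T : ℝ) : Finset ℂ :=
  (finite_nontrivialZeros_inter (differentiable_famF ψ) (famF_two_ne_zero ψ) T).toFinset

/-- Membership in `famFin`. [folklore] -/
theorem mem_famFin {ψ : AddChar (Additive (ClassGroup (𝓞 K))) ℂ} {T : ℝ} {ρ : ℂ} :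
    ρ ∈ famFin K ψ T ↔ (famF K ψ ρ = 0 ∧ 0 < ρ.re ∧ ρ.re < 1) ∧ |ρ.im| ≤ T := by
  rw [famFin, Set.Finite.mem_toFinset]; rfl

/-- **The finite part of the zero sum of the family** (Thorner–Zaman Lemma 4.5 + 4.6 for `Ĉl_K`):
with `b, D` of `fam_density`, for `c > 0`, an imaginary quadratic `K` satisfying clause (1) of the
Landau–Page package with constant `c`, `x > 1` and `T₁ ≥ 1` with `e^{b(2 log Q + log(2T₁+4))} ≤ x^{1/2}`:
`Σ_ψ Σ_{ρ ∈ famFin ψ T₁, ¬exc, β ≥ 1/4} m x^{β−1}/max(1,|γ|) ≤ 64 D (e^{−cL/(8 log Q)} + e^{−√(cL/4)})`.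
[cite: ThornerZaman2019, Lemmas 4.5–4.6] -/
theorem fam_finitePart_le {b D : ℝ} (hb : 0 < b) (hD : 0 < D)
    (hdens : ∀ (K : Type) [Field K] [NumberField K], Module.finrank ℚ K = 2 → NumberField.IsTotallyComplex K →
      ∀ (T : ℝ), 1 ≤ T → ∀ u : AddChar (Additive (ClassGroup (𝓞 K))) ℂ → Finset ℂ,
        (∀ ψ, ∀ ρ ∈ u ψ, famF K ψ ρ = 0 ∧ 1 / 4 ≤ ρ.re ∧ ρ.re < 1 ∧ |ρ.im| ≤ T) →
        ∀ α : ℝ, α ≤ 1 →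
          ∑ ψ, ∑ ρ ∈ u ψ with α ≤ ρ.re, (famMult K ψ ρ : ℝ) ≤
            D * Real.exp (b * (2 * Real.log (ThornerZaman.condQ K) + Real.log (T + 4))) ^ (1 - α))
    {c : ℝ} (hc : 0 < c) (h2 : Module.finrank ℚ K = 2) (htc : NumberField.IsTotallyComplex K)
    (hpack : ∀ (χ : ClassGroup (𝓞 K) →* ℂˣ) (ρ : ℂ),
      (((χ = 1 → dedekindZeta₁ K ρ = 0) ∧ (χ ≠ 1 → classGroupLFunction₀ K χ ρ = 0)) ∧
        1 - c / (Real.log ((NumberField.discr K).natAbs : ℝ) + Real.log (|ρ.im| + 4)) < ρ.re) → ρ.im = 0 ∧ χ * χ = 1)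
    {x T₁ : ℝ} (hx : 1 < x) (hT₁ : 1 ≤ T₁)
    (hrange : Real.exp (b * (2 * Real.log (ThornerZaman.condQ K) + Real.log (2 * T₁ + 4))) ≤ x ^ ((1 : ℝ) / 2)) :
    ∑ ψ, ∑ ρ ∈ famFin K ψ T₁ with (¬ excRegion c K ρ ∧ 1 / 4 ≤ ρ.re),
        (famMult K ψ ρ : ℝ) * x ^ (ρ.re - 1) / max 1 |ρ.im| ≤
      64 * D * (Real.exp (-(c * Real.log x / (8 * Real.log (ThornerZaman.condQ K)))) +
        Real.exp (-Real.sqrt (c * Real.log x / 4))) := by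
  classical
  set Q : ℝ := ThornerZaman.condQ K with hQ
  have hQ12 : (12 : ℝ) ≤ Q := ThornerZaman.twelve_le_condQ (K := K) (by rw [h2]; norm_num)
  have hlogQ : Real.log 12 ≤ Real.log Q := Real.log_le_log (by norm_num) hQ12
  have hlog12 : (2 : ℝ) ≤ Real.log 12 := by
    rw [Real.le_log_iff_exp_le (by norm_num)]
    have := Real.exp_one_lt_d9
    have h : Real.exp 2 = Real.exp 1 * Real.exp 1 := by rw [← Real.exp_add]; norm_num
    rw [h]; nlinarith [Real.exp_pos (1:ℝ)]
  set 𝓠 : ℝ := 2 * Real.log Q with h𝓠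
  have h𝓠1 : 1 ≤ 𝓠 := by linarith
  -- the index set of pairs
  set Fin' : AddChar (Additive (ClassGroup (𝓞 K))) ℂ → Finset ℂ := fun ψ ↦
    (famFin K ψ T₁).filter (fun ρ ↦ ¬ excRegion c K ρ ∧ 1 / 4 ≤ ρ.re) with hFin'
  set s : Finset (Σ _ : AddChar (Additive (ClassGroup (𝓞 K))) ℂ, ℂ) := Finset.univ.sigma Fin' with hs
  have hmem : ∀ i ∈ s, (famF K i.1 i.2 = 0 ∧ 0 < i.2.re ∧ i.2.re < 1) ∧ |i.2.im| ≤ T₁ ∧ ¬ excRegion c K i.2 ∧ 1 / 4 ≤ i.2.re := by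
    rintro ⟨ψ, ρ⟩ hi
    rw [hs, Finset.mem_sigma] at hi
    obtain ⟨-, hρ⟩ := hi
    rw [hFin'] at hρ; dsimp only at hρ
    rw [Finset.mem_filter, mem_famFin] at hρ
    exact ⟨hρ.1.1, hρ.1.2, hρ.2.1, hρ.2.2⟩
  have hconv : ∑ ψ, ∑ ρ ∈ famFin K ψ T₁ with (¬ excRegion c K ρ ∧ 1 / 4 ≤ ρ.re),
      (famMult K ψ ρ : ℝ) * x ^ (ρ.re - 1) / max 1 |ρ.im| =
      ∑ i ∈ s, (famMult K i.1 i.2 : ℝ) * x ^ (i.2.re - 1) / max 1 |i.2.im| := by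
    rw [hs, Finset.sum_sigma]
  rw [hconv]
  have key := LinnikZeroSum.sum_rpow_div_le_of_density_zfr s (fun i ↦ i.2.re) (fun i ↦ i.2.im)
    (fun i ↦ (famMult K i.1 i.2 : ℝ)) (𝓠 := 𝓠) (c_Z := c) (b := b) (D₀ := D) (T₁ := T₁)
    hx h𝓠1 hc hb.le hD.le hT₁ (fun i _ ↦ Nat.cast_nonneg _) (fun i hi ↦ (hmem i hi).2.1) ?_ ?_ ?_
  · refine key.trans (le_of_eq ?_)
    rw [h𝓠]; congr 3; ring
  · -- zero-free region off the exceptional segment, with `𝓠 = 2 log Q ≥ log|d_K|`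
    intro i hi
    obtain ⟨⟨h0, -, -⟩, -, hexc, -⟩ := hmem i hi
    have h1 := re_le_of_not_excRegion hpack i.1 h0 hexc
    have hdQ : Real.log ((NumberField.discr K).natAbs : ℝ) ≤ 𝓠 := by
      have hd1 : (1 : ℝ) ≤ ((NumberField.discr K).natAbs : ℝ) := by
        have h1 : 1 ≤ (NumberField.discr K).natAbs :=
          Nat.one_le_iff_ne_zero.2 (Int.natAbs_ne_zero.2 (NumberField.discr_ne_zero K))
        exact_mod_cast h1
      have hdQ' : ((NumberField.discr K).natAbs : ℝ) ≤ Q := by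
        rw [hQ, ThornerZaman.condQ, Nat.cast_natAbs, Int.cast_abs]
        linarith [abs_nonneg ((NumberField.discr K : ℝ))]
      have := Real.log_le_log (by linarith) hdQ'
      have h0Q : 0 ≤ Real.log Q := by linarith
      linarith
    have hlog4 : 0 < Real.log (|i.2.im| + 4) := Real.log_pos (by linarith [abs_nonneg i.2.im])
    have hlogd : 0 ≤ Real.log ((NumberField.discr K).natAbs : ℝ) := Real.log_natCast_nonneg _
    have : c / (𝓠 + Real.log (|i.2.im| + 4)) ≤ c / (Real.log ((NumberField.discr K).natAbs : ℝ) + Real.log (|i.2.im| + 4)) :=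
      div_le_div_of_nonneg_left hc.le (by linarith) (by linarith)
    linarith
  · -- density
    intro T α hT hα
    have hd' := hdens K h2 htc T hT (fun ψ ↦ (Fin' ψ).filter (fun ρ ↦ |ρ.im| ≤ T)) (fun ψ ρ hρ ↦ ?_) α hα
    · refine le_of_eq_of_le ?_ hd'
      rw [hs]
      rw [show (∑ i ∈ (Finset.univ.sigma Fin') with (|i.2.im| ≤ T ∧ α ≤ i.2.re), (famMult K i.1 i.2 : ℝ)) =
          ∑ i ∈ Finset.univ.sigma (fun ψ ↦ ((Fin' ψ).filter (fun ρ ↦ |ρ.im| ≤ T)).filter (fun ρ ↦ α ≤ ρ.re)),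
            (famMult K i.1 i.2 : ℝ) by
        refine Finset.sum_congr ?_ fun _ _ ↦ rfl
        ext ⟨ψ, ρ⟩
        simp only [Finset.mem_filter, Finset.mem_sigma, Finset.mem_univ, true_and]
        tauto]
      rw [Finset.sum_sigma]
    · rw [Finset.mem_filter] at hρ
      rw [hFin'] at hρ; dsimp only at hρ
      rw [Finset.mem_filter, mem_famFin] at hρ
      exact ⟨hρ.1.1.1.1, hρ.1.2.2, hρ.1.1.1.2.2, hρ.2⟩
  · rwa [h𝓠]


/-! ### The junk terms -/

set_option maxHeartbeats 1600000 in
/-- The real-variable bookkeeping for the junk terms: with `x^{−ν} ≤ ε ≤ 1`, `T₁ = x^{6ν}`, `L = log x`,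
`0 < ν ≤ 1/64`, `Q³ ≤ x^ν`, `Q ≥ 12`, `h ≤ Q²`, `A ≤ 4Q`:
`h · ((L + ε + 8M) x^{−3/4} (2T₁ + 3) W (A + log(T₁ + 5)) + (2M/ε) T₁^{−1/2} W (c₁A + c₂)) ≤ A₁ x^{−ν}`,
`A₁ = 50W(1/ν + 1 + 8M) + 2MW(4c₁ + c₂)`. [folklore] -/
theorem junk_le {ν x Q h A M W c₁ c₂ e : ℝ} (hν : 0 < ν) (hν64 : ν ≤ 1 / 64) (hQ : 12 ≤ Q) (hx : Q ^ 3 ≤ x ^ ν)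
    (hx1 : 1 < x) (hh0 : 0 ≤ h) (hh : h ≤ Q ^ 2) (hA0 : 0 ≤ A) (hA : A ≤ 4 * Q) (hM : 1 ≤ M) (hW : 0 ≤ W)
    (hc₁ : 0 ≤ c₁) (hc₂ : 0 ≤ c₂) (he : x ^ (-ν) ≤ e) (he1 : e ≤ 1) :
    h * ((Real.log x + e + 8 * M) * x ^ (-(3 : ℝ) / 4) * ((2 * x ^ (6 * ν) + 3) * (W * (A + Real.log (x ^ (6 * ν) + 5)))) +
      (2 * M / e) * (x ^ (6 * ν)) ^ (-((1 : ℝ) / 2)) * (W * (c₁ * A + c₂))) ≤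
      (50 * W * (1 / ν + 1 + 8 * M) + 2 * M * W * (4 * c₁ + c₂)) * x ^ (-ν) := by
  have hx0 : 0 < x := by linarith
  have hQ1 : (1 : ℝ) ≤ Q := by linarith
  have hQ0 : (0 : ℝ) ≤ Q := by linarith
  set Lx := Real.log x with hL
  have hL0 : 0 < Lx := Real.log_pos hx1
  set y : ℝ := x ^ ν with hy
  have hy1 : 1 ≤ y := Real.one_le_rpow hx1.le hν.le
  have hy0 : 0 < y := by linarith
  have hQ3y : Q ^ 3 ≤ y := hx
  have hQy : Q ≤ y := by nlinarith [one_le_pow₀ (n := 2) hQ1]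
  have hLy : Lx ≤ y / ν := by rw [hL, hy]; exact Real.log_le_rpow_div hx0.le hν
  -- rewrite the powers of `x` through `y`
  have hε : x ^ (-ν) = y⁻¹ := by rw [hy, Real.rpow_neg hx0.le]
  have hT : x ^ (6 * ν) = y ^ (6 : ℕ) := by
    rw [hy, ← Real.rpow_natCast, ← Real.rpow_mul hx0.le]; congr 1; push_cast; ring
  have hThalf : (x ^ (6 * ν)) ^ (-((1 : ℝ) / 2)) = (y ^ (3 : ℕ))⁻¹ := by
    rw [← Real.rpow_mul hx0.le, show 6 * ν * -((1 : ℝ) / 2) = -(3 * ν) by ring, Real.rpow_neg hx0.le, hy,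
      ← Real.rpow_natCast, ← Real.rpow_mul hx0.le]
    congr 2; push_cast; ring
  have hx34 : x ^ (-(3 : ℝ) / 4) ≤ (y ^ (13 : ℕ))⁻¹ := by
    have h1 : x ^ (-(3 : ℝ) / 4) ≤ x ^ (-(13 * ν)) := Real.rpow_le_rpow_of_exponent_le hx1.le (by linarith)
    have h2 : x ^ (-(13 * ν)) = (y ^ (13 : ℕ))⁻¹ := by
      rw [Real.rpow_neg hx0.le, hy, ← Real.rpow_natCast, ← Real.rpow_mul hx0.le]; congr 2; push_cast; ring
    rw [← h2]; exact h1
  rw [hThalf, hε, hT]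
  have hey : y⁻¹ ≤ e := by rw [← hε]; exact he
  have he0 : 0 < e := lt_of_lt_of_le (by positivity) hey
  have hy6 : (1 : ℝ) ≤ y ^ (6 : ℕ) := one_le_pow₀ hy1
  -- Term 1
  have hlog6 : Real.log (y ^ (6 : ℕ) + 5) ≤ 6 * y := by
    have h1 : Real.log (y ^ (6 : ℕ) + 5) ≤ Real.log (6 * y ^ (6 : ℕ)) := Real.log_le_log (by positivity) (by linarith)
    rw [Real.log_mul (by norm_num) (by positivity), Real.log_pow] at h1
    have h2 : Real.log y ≤ y - 1 := Real.log_le_sub_one_of_pos hy0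
    have h3 : Real.log 6 ≤ 2 := by
      rw [Real.log_le_iff_le_exp (by norm_num)]
      have := Real.exp_one_gt_d9
      have h : Real.exp 2 = Real.exp 1 * Real.exp 1 := by rw [← Real.exp_add]; norm_num
      rw [h]; nlinarith
    push_cast at h1; linarith
  have hf1 : Real.log x + e + 8 * M ≤ (1 / ν + 1 + 8 * M) * y := by
    have hM0 : 0 ≤ M := by linarith
    rw [← hL]
    have : 1 / ν * y = y / ν := by ring
    nlinarith
  have hf2 : 2 * y ^ (6 : ℕ) + 3 ≤ 5 * y ^ (6 : ℕ) := by linarith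
  have hf3 : A + Real.log (y ^ (6 : ℕ) + 5) ≤ 10 * y := by linarith
  have hM0 : 0 ≤ M := by linarith
  have hterm1 : h * ((Real.log x + e + 8 * M) * (y ^ (13 : ℕ))⁻¹ * ((2 * y ^ (6 : ℕ) + 3) * (W * (A + Real.log (y ^ (6 : ℕ) + 5))))) ≤
      50 * W * (1 / ν + 1 + 8 * M) * y⁻¹ := by
    have hlogA : 0 ≤ A + Real.log (y ^ (6 : ℕ) + 5) := by
      have : 0 ≤ Real.log (y ^ (6 : ℕ) + 5) := Real.log_nonneg (by linarith); linarith
    have hLpos : 0 ≤ Real.log x + e + 8 * M := by rw [← hL]; positivity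
    calc h * ((Real.log x + e + 8 * M) * (y ^ (13 : ℕ))⁻¹ * ((2 * y ^ (6 : ℕ) + 3) * (W * (A + Real.log (y ^ (6 : ℕ) + 5)))))
        ≤ y ^ 2 * (((1 / ν + 1 + 8 * M) * y) * (y ^ (13 : ℕ))⁻¹ * ((5 * y ^ (6 : ℕ)) * (W * (10 * y)))) := by
          refine mul_le_mul (hh.trans (by nlinarith)) ?_ (by positivity) (by positivity)
          refine mul_le_mul (mul_le_mul_of_nonneg_right hf1 (by positivity)) ?_ (by positivity) (by positivity)
          exact mul_le_mul hf2 (mul_le_mul_of_nonneg_left hf3 hW) (by positivity) (by positivity)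
      _ = 50 * W * (1 / ν + 1 + 8 * M) * y⁻¹ * (y ^ (11 : ℕ) * (y ^ (13 : ℕ))⁻¹) := by
          field_simp; ring
      _ ≤ 50 * W * (1 / ν + 1 + 8 * M) * y⁻¹ * 1 := by
          refine mul_le_mul_of_nonneg_left ?_ (by positivity)
          rw [mul_inv_le_iff₀ (by positivity), one_mul]
          exact pow_le_pow_right₀ hy1 (by norm_num)
      _ = 50 * W * (1 / ν + 1 + 8 * M) * y⁻¹ := mul_one _
  -- Term 2
  have hterm2 : h * ((2 * M / e) * (y ^ (3 : ℕ))⁻¹ * (W * (c₁ * A + c₂))) ≤ 2 * M * W * (4 * c₁ + c₂) * y⁻¹ := by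
    have hcA : c₁ * A + c₂ ≤ (4 * c₁ + c₂) * Q := by nlinarith
    have hMe : 2 * M / e ≤ 2 * M / y⁻¹ := div_le_div_of_nonneg_left (by linarith) (by positivity) hey
    calc h * ((2 * M / e) * (y ^ (3 : ℕ))⁻¹ * (W * (c₁ * A + c₂)))
        ≤ Q ^ 2 * ((2 * M / y⁻¹) * (y ^ (3 : ℕ))⁻¹ * (W * ((4 * c₁ + c₂) * Q))) := by
          refine mul_le_mul hh (mul_le_mul (mul_le_mul_of_nonneg_right hMe (by positivity))
            (mul_le_mul_of_nonneg_left hcA hW) (by positivity) (by positivity)) (by positivity) (by positivity)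
      _ = 2 * M * W * (4 * c₁ + c₂) * y⁻¹ * (Q ^ 3 * y⁻¹) := by
          have hy0' : y ≠ 0 := hy0.ne'
          rw [div_inv_eq_mul]; field_simp
      _ ≤ 2 * M * W * (4 * c₁ + c₂) * y⁻¹ * 1 := by
          refine mul_le_mul_of_nonneg_left ?_ (by positivity)
          rw [mul_inv_le_iff₀ hy0, one_mul]; exact hQ3y
      _ = _ := mul_one _
  rw [mul_add]
  calc _ ≤ 50 * W * (1 / ν + 1 + 8 * M) * y⁻¹ + 2 * M * W * (4 * c₁ + c₂) * y⁻¹ := by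
        refine add_le_add (le_trans ?_ hterm1) hterm2
        refine mul_le_mul_of_nonneg_left ?_ hh0
        refine mul_le_mul_of_nonneg_right (mul_le_mul_of_nonneg_left hx34 ?_) ?_
        · have hLx : 0 ≤ Real.log x := hL ▸ hL0.le
          linarith
        · have : 0 ≤ Real.log (y ^ (6 : ℕ) + 5) := Real.log_nonneg (by linarith)
          positivity
    _ = _ := by ring


/-! ### The zero sum of the family -/

set_option maxHeartbeats 4000000 in
/-- **Thorner–Zaman §4.3 for `Ĉl_K`, uniformly in the imaginary quadratic field `K`**: there are
absolute `ν ∈ (0, 1/64]`, `a₀ ≥ 1`, `A₀ > 0` such that for every `c > 0`, every imaginary quadratic `K`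
satisfying clause (1) of the Landau–Page package with constant `c`, every `x ≥ Q^{a₀}` and all finite
sets `u ψ` of non-trivial zeros of `F_ψ`, the zero terms against the weight `tzTest (log x) ε`
(`x^{−ν} ≤ ε ≤ 1`) off the exceptional segment satisfy
`Σ_ψ Σ_{ρ ∈ u ψ, ¬exc} m_ψ(ρ) ‖F(−ρ)‖ ≤ A₀ x (e^{−c L/(8 log Q)} + e^{−√(cL/4)}) + A₀ x^{1−ν}`.
[cite: ThornerZaman2019, §4.3 (Lemmas 4.4–4.6)] -/
theorem fam_zeroSum_le : ∃ ν a₀ A₀ : ℝ, 0 < ν ∧ ν ≤ 1 / 64 ∧ 1 ≤ a₀ ∧ 0 < A₀ ∧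
    ∀ (c : ℝ), 0 < c → ∀ (K : Type) [Field K] [NumberField K], Module.finrank ℚ K = 2 → NumberField.IsTotallyComplex K →
      (∀ (χ : ClassGroup (𝓞 K) →* ℂˣ) (ρ : ℂ),
        (((χ = 1 → dedekindZeta₁ K ρ = 0) ∧ (χ ≠ 1 → classGroupLFunction₀ K χ ρ = 0)) ∧
          1 - c / (Real.log ((NumberField.discr K).natAbs : ℝ) + Real.log (|ρ.im| + 4)) < ρ.re) → ρ.im = 0 ∧ χ * χ = 1) →
      ∀ x : ℝ, ThornerZaman.condQ K ^ a₀ ≤ x → ∀ ε : ℝ, x ^ (-ν) ≤ ε → ε ≤ 1 →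
      ∀ u : AddChar (Additive (ClassGroup (𝓞 K))) ℂ → Finset ℂ,
        (∀ ψ, ∀ ρ ∈ u ψ, famF K ψ ρ = 0 ∧ 0 < ρ.re ∧ ρ.re < 1) →
        ∑ ψ, ∑ ρ ∈ u ψ with ¬ excRegion c K ρ,
            (famMult K ψ ρ : ℝ) * ‖fordLaplace (TZWeight.tzTest (Real.log x) ε) (-ρ)‖ ≤
          A₀ * x * (Real.exp (-(c * Real.log x / (8 * Real.log (ThornerZaman.condQ K)))) +
              Real.exp (-Real.sqrt (c * Real.log x / 4))) + A₀ * x ^ (1 - ν) := by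
  classical
  obtain ⟨b, D, hb, hD, hdens⟩ := fam_density
  obtain ⟨M, hM1, hM⟩ := TZWeight.exists_smoothTransition_deriv_bound
  obtain ⟨hc₁16, hc₂0⟩ := tailConst_nonneg
  set β₀ : ℝ := max b 1 with hβ₀
  have hβ₀1 : 1 ≤ β₀ := le_max_right _ _
  have hbβ₀ : b ≤ β₀ := le_max_left _ _
  set ν : ℝ := 1 / (64 * β₀) with hν
  have hν0 : 0 < ν := by positivity
  have hν64 : ν ≤ 1 / 64 := by
    rw [hν]; exact one_div_le_one_div_of_le (by norm_num) (by nlinarith)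
  set a₀ : ℝ := 400 * β₀ with ha₀
  set W₀ : ℝ := 1536 with hW₀
  set A₁ : ℝ := 50 * W₀ * (1 / ν + 1 + 8 * M) + 2 * M * W₀ * (4 * tailConst₁ + tailConst₂) with hA₁
  have hA₁0 : 0 ≤ A₁ := by
    have : 0 ≤ M := by linarith
    have : 0 ≤ tailConst₁ := by linarith
    positivity
  set A₀ : ℝ := Real.exp 1 * (512 * M * D + A₁) with hA₀
  refine ⟨ν, a₀, A₀, hν0, hν64, by rw [ha₀]; linarith, by positivity, fun c hc K _ _ h2 htc hpack x hx ε hεν hε1 u hu ↦ ?_⟩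
  -- sizes
  have hd : NumberField.discr K < 0 := discr_neg_of_isTotallyComplex h2 htc
  set Q : ℝ := ThornerZaman.condQ K with hQ
  have hQ12 : (12 : ℝ) ≤ Q := ThornerZaman.twelve_le_condQ (K := K) (by rw [h2]; norm_num)
  have hQ1 : (1 : ℝ) < Q := by linarith
  have hlog12 : (2 : ℝ) ≤ Real.log 12 := by
    rw [Real.le_log_iff_exp_le (by norm_num)]
    have := Real.exp_one_lt_d9
    have h : Real.exp 2 = Real.exp 1 * Real.exp 1 := by rw [← Real.exp_add]; norm_num
    rw [h]; nlinarith [Real.exp_pos (1:ℝ)]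
  have hlogQ : 2 ≤ Real.log Q := hlog12.trans (Real.log_le_log (by norm_num) hQ12)
  have ha₀1 : (1 : ℝ) ≤ a₀ := by rw [ha₀]; linarith
  have hxQ : Q ≤ x := by
    have : Q ^ (1 : ℝ) ≤ Q ^ a₀ := Real.rpow_le_rpow_of_exponent_le hQ1.le ha₀1
    rw [Real.rpow_one] at this; linarith
  have hx1 : 1 < x := by linarith
  have hx0 : 0 < x := by linarith
  set Lx : ℝ := Real.log x with hLx
  have hLQ : a₀ * Real.log Q ≤ Lx := by
    have := Real.log_le_log (by positivity) hx
    rwa [Real.log_rpow (by linarith)] at this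
  have hL800 : 800 * β₀ ≤ Lx := by nlinarith
  have hL0 : 0 < Lx := by linarith
  have hε0 : 0 < ε := lt_of_lt_of_le (Real.rpow_pos_of_pos hx0 _) hεν
  have hεL : ε < Lx / 2 := by linarith
  set T₁ : ℝ := x ^ (6 * ν) with hT₁
  have hT₁1 : 1 ≤ T₁ := Real.one_le_rpow hx1.le (by positivity)
  -- the window data of the family (`n = 2`)
  set A : ℝ := Real.log ((NumberField.discr K).natAbs : ℝ) + 6 with hA
  have hAnn : 0 ≤ A := by have := Real.log_natCast_nonneg (NumberField.discr K).natAbs; positivity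
  have hwin : ∀ ψ (τ : ℝ) (P : Finset ℂ), (∀ ρ ∈ P, famF K ψ ρ = 0 ∧ 0 < ρ.re ∧ ρ.re < 1 ∧ |ρ.im - τ| ≤ 1 / 2) →
      ∑ ρ ∈ P, (analyticOrderNatAt (famF K ψ) ρ : ℝ) ≤ W₀ * (A + Real.log (|τ| + 4)) := by
    intro ψ τ P hP
    have := fam_window ψ τ P hP
    rw [h2] at this
    convert this using 2 <;> [rw [hW₀]; rw [hA]] <;> push_cast <;> ring
  -- (A) per character
  set g : AddChar (Additive (ClassGroup (𝓞 K))) ℂ → ℂ → ℝ := fun ψ ρ ↦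
    (famMult K ψ ρ : ℝ) * ‖fordLaplace (TZWeight.tzTest Lx ε) (-ρ)‖ with hg
  set S : AddChar (Additive (ClassGroup (𝓞 K))) ℂ → ℝ := fun ψ ↦
    ∑ ρ ∈ famFin K ψ T₁ with (¬ excRegion c K ρ ∧ 1 / 4 ≤ ρ.re), (famMult K ψ ρ : ℝ) * x ^ (ρ.re - 1) / max 1 |ρ.im| with hS
  set J : ℝ := (Lx + ε + 8 * M) * x ^ (-(3 : ℝ) / 4) * ((2 * T₁ + 3) * (W₀ * (A + Real.log (T₁ + 5)))) +
    (2 * M / ε) * T₁ ^ (-((1 : ℝ) / 2)) * (W₀ * (tailConst₁ * A + tailConst₂)) with hJ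
  have hexpL : Real.exp Lx = x := by rw [hLx, Real.exp_log hx0]
  have hper : ∀ ψ, ∑ ρ ∈ u ψ with ¬ excRegion c K ρ, g ψ ρ ≤ Real.exp ε * x * (8 * M * S ψ + J) := by
    intro ψ
    have hdp : DecidablePred (· ∈ nontrivialZeros (famF K ψ)) := fun _ ↦ Classical.propDecidable _
    set Exc : Finset ℂ := (famFin K ψ T₁ ∪ u ψ).filter (excRegion c K) with hExc
    set u' : Finset (nontrivialZeros (famF K ψ)) :=
      ((u ψ).filter (fun ρ ↦ ¬ excRegion c K ρ)).subtype (· ∈ nontrivialZeros (famF K ψ)) with hu'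
    have key := sum_zeroTerm_le (differentiable_famF ψ) (famF_two_ne_zero ψ) (W := W₀) (A := A)
      (by rw [hW₀]; norm_num) hAnn (hwin ψ) hM hL0 hε0 hεL hT₁1 Exc u'
    -- the left side
    have h1 : u'.filter (fun ρ' : nontrivialZeros (famF K ψ) ↦ (ρ' : ℂ) ∉ Exc) = u' := by
      refine Finset.filter_true_of_mem fun ρ' hρ' ↦ ?_
      rw [hu', Finset.mem_subtype, Finset.mem_filter] at hρ'
      rw [hExc, Finset.mem_filter, not_and_or]
      exact Or.inr hρ'.2
    rw [h1] at key
    have hLHS : ∑ ρ' ∈ u', (analyticOrderNatAt (famF K ψ) (ρ' : ℂ) : ℝ) * ‖fordLaplace (TZWeight.tzTest Lx ε) (-(ρ' : ℂ))‖ =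
        ∑ ρ ∈ u ψ with ¬ excRegion c K ρ, g ψ ρ := by
      rw [hu', Finset.sum_subtype_of_mem (fun ρ : ℂ ↦ (analyticOrderNatAt (famF K ψ) ρ : ℝ) * ‖fordLaplace (TZWeight.tzTest Lx ε) (-ρ)‖)]
      · exact Finset.sum_congr rfl fun _ _ ↦ rfl
      intro ρ hρ
      rw [Finset.mem_filter] at hρ
      exact hu ψ ρ hρ.1
    rw [hLHS] at key
    refine key.trans ?_
    rw [hexpL]
    refine mul_le_mul_of_nonneg_left ?_ (by positivity)
    rw [add_assoc]
    refine add_le_add ?_ ?_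
    · -- the finite part: the filter `ρ ∉ Exc` is `¬ excRegion` on `famFin`
      refine mul_le_mul_of_nonneg_left (le_of_eq ?_) (by positivity)
      rw [hS]; dsimp only
      change ∑ ρ ∈ (famFin K ψ T₁).filter (fun ρ ↦ ρ ∉ Exc ∧ 1 / 4 ≤ ρ.re), _ = _
      refine Finset.sum_congr (Finset.filter_congr fun ρ hρ ↦ ?_) fun _ _ ↦ rfl
      rw [hExc, Finset.mem_filter, not_and_or]
      constructor
      · rintro ⟨h | h, h14⟩
        · exact absurd (Finset.mem_union_left _ hρ) h
        · exact ⟨h, h14⟩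
      · rintro ⟨h, h14⟩; exact ⟨Or.inr h, h14⟩
    · -- the junk of `ψ`
      rw [hJ]
      refine add_le_add (mul_le_mul_of_nonneg_left ?_ ?_) le_rfl
      · change ∑ ρ ∈ famFin K ψ T₁, (analyticOrderNatAt (famF K ψ) ρ : ℝ) ≤ _
        refine sum_mult_le_of_window (by rw [hW₀]; norm_num) hAnn (hwin ψ) (by linarith) _ fun ρ hρ ↦ ?_
        rw [mem_famFin] at hρ
        exact ⟨hρ.1.1, hρ.1.2.1, hρ.1.2.2, hρ.2⟩
      · have : 0 ≤ M := by linarith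
        positivity
  -- (B) sum over `ψ`
  have hsum : ∑ ψ, ∑ ρ ∈ u ψ with ¬ excRegion c K ρ, g ψ ρ ≤ Real.exp ε * x * (8 * M * ∑ ψ, S ψ + (NumberField.classNumber K : ℝ) * J) := by
    refine (Finset.sum_le_sum fun ψ _ ↦ hper ψ).trans (le_of_eq ?_)
    rw [← Finset.mul_sum, Finset.sum_add_distrib, Finset.mul_sum, Finset.sum_const, nsmul_eq_mul, Finset.card_univ,
      card_addChar_classGroup]
  -- (C) the finite part by density + ZFR
  have hrange : Real.exp (b * (2 * Real.log Q + Real.log (2 * T₁ + 4))) ≤ x ^ ((1 : ℝ) / 2) := by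
    rw [show x ^ ((1 : ℝ) / 2) = Real.exp (Lx / 2) by rw [hLx, Real.rpow_def_of_pos hx0]; ring_nf]
    refine Real.exp_le_exp.2 ?_
    have hT6 : Real.log (2 * T₁ + 4) ≤ 2 + 6 * ν * Lx := by
      have h1 : Real.log (2 * T₁ + 4) ≤ Real.log (6 * T₁) :=
        Real.log_le_log (by linarith only [hT₁1]) (by linarith only [hT₁1])
      rw [Real.log_mul (by norm_num) (by linarith only [hT₁1]), hT₁, Real.log_rpow hx0, ← hLx] at h1
      have h3 : Real.log 6 ≤ 2 := by
        rw [Real.log_le_iff_le_exp (by norm_num)]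
        have := Real.exp_one_gt_d9
        have h : Real.exp 2 = Real.exp 1 * Real.exp 1 := by rw [← Real.exp_add]; norm_num
        rw [h]; nlinarith only [this]
      linarith only [h1, h3]
    have hbν : b * (6 * ν * Lx) ≤ 6 / 64 * Lx := by
      have hbν' : b * ν ≤ 1 / 64 := by
        rw [hν]; rw [show b * (1 / (64 * β₀)) = b / β₀ / 64 by ring]
        have : b / β₀ ≤ 1 := (div_le_one (by positivity)).2 hbβ₀
        linarith
      have : b * (6 * ν * Lx) = 6 * (b * ν) * Lx := by ring
      rw [this]
      have := mul_le_mul_of_nonneg_right hbν' hL0.le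
      linarith only [this]
    have hb2 : b * 2 ≤ Lx / 400 := by linarith only [hbβ₀, hL800]
    have hbQ : b * (2 * Real.log Q) ≤ Lx / 200 := by
      have h0Q : 0 ≤ Real.log Q := by linarith only [hlogQ]
      have h1 : b * (2 * Real.log Q) ≤ β₀ * (2 * Real.log Q) := mul_le_mul_of_nonneg_right hbβ₀ (by positivity)
      have h2' : β₀ * (2 * Real.log Q) = (a₀ * Real.log Q) / 200 := by rw [ha₀]; ring
      rw [h2'] at h1
      have h3 : (a₀ * Real.log Q) / 200 ≤ Lx / 200 := by linarith only [hLQ]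
      linarith only [h1, h3]
    have h4 : b * Real.log (2 * T₁ + 4) ≤ b * 2 + b * (6 * ν * Lx) := by
      have := mul_le_mul_of_nonneg_left hT6 hb.le; linarith only [this]
    have h5 : b * (2 * Real.log Q + Real.log (2 * T₁ + 4)) = b * (2 * Real.log Q) + b * Real.log (2 * T₁ + 4) := by ring
    rw [h5]
    linarith only [hbQ, h4, hbν, hb2, hL0]
  have hfin := fam_finitePart_le hb hD hdens hc h2 htc hpack hx1 hT₁1 hrange
  -- (D) the junk
  have hh : (NumberField.classNumber K : ℝ) ≤ Q ^ 2 := by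
    have h1 : (NumberField.classNumber K : ℝ) ≤ (NumberField.discr K : ℝ) ^ 2 := classNumber_le_discr_sq h2 htc
    have h2' : (NumberField.discr K : ℝ) ^ 2 ≤ Q ^ 2 := by
      rw [hQ, ThornerZaman.condQ, ← sq_abs]
      exact pow_le_pow_left₀ (abs_nonneg _) (by linarith [abs_nonneg ((NumberField.discr K : ℝ))]) 2
    linarith
  have hAQ : A ≤ 4 * Q := by
    have hdQ' : ((NumberField.discr K).natAbs : ℝ) ≤ Q := by
      rw [hQ, ThornerZaman.condQ, Nat.cast_natAbs, Int.cast_abs]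
      linarith [abs_nonneg ((NumberField.discr K : ℝ))]
    have hd1 : (1 : ℝ) ≤ ((NumberField.discr K).natAbs : ℝ) := by
      have h1 : 1 ≤ (NumberField.discr K).natAbs :=
        Nat.one_le_iff_ne_zero.2 (Int.natAbs_ne_zero.2 (NumberField.discr_ne_zero K))
      exact_mod_cast h1
    have := Real.log_le_sub_one_of_pos (by linarith : (0:ℝ) < ((NumberField.discr K).natAbs : ℝ))
    rw [hA]; linarith
  have hQ3 : Q ^ 3 ≤ x ^ ν := by
    have h1 : Q ^ 3 = Real.exp (3 * Real.log Q) := by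
      rw [← Real.rpow_natCast, Real.rpow_def_of_pos (by linarith)]; norm_num; ring_nf
    rw [h1, Real.rpow_def_of_pos hx0, ← hLx]
    refine Real.exp_le_exp.2 ?_
    have haν : a₀ * ν = 400 / 64 := by rw [ha₀, hν]; field_simp
    have h2' : ν * (a₀ * Real.log Q) ≤ ν * Lx := mul_le_mul_of_nonneg_left hLQ hν0.le
    have h3 : ν * (a₀ * Real.log Q) = 400 / 64 * Real.log Q := by rw [← haν]; ring
    have h0Q : 0 ≤ Real.log Q := by linarith only [hlogQ]
    linarith only [h2', h3, h0Q]
  have hjunk : (NumberField.classNumber K : ℝ) * J ≤ A₁ * x ^ (-ν) := by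
    rw [hJ, hA₁, hT₁, hLx]
    exact junk_le hν0 hν64 hQ12 hQ3 hx1 (Nat.cast_nonneg _) hh hAnn hAQ hM1 (by rw [hW₀]; norm_num)
      (by linarith) hc₂0 hεν hε1
  -- (E) assemble
  have hεe : Real.exp ε ≤ Real.exp 1 := Real.exp_le_exp.2 hε1
  set E : ℝ := Real.exp (-(c * Real.log x / (8 * Real.log Q))) + Real.exp (-Real.sqrt (c * Real.log x / 4)) with hE
  have hE0 : 0 ≤ E := by positivity
  have hM0 : 0 ≤ M := by linarith
  have hxν : x * x ^ (-ν) = x ^ (1 - ν) := by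
    rw [sub_eq_add_neg, Real.rpow_add hx0, Real.rpow_one]
  calc ∑ ψ, ∑ ρ ∈ u ψ with ¬ excRegion c K ρ, g ψ ρ
      ≤ Real.exp ε * x * (8 * M * ∑ ψ, S ψ + (NumberField.classNumber K : ℝ) * J) := hsum
    _ ≤ Real.exp 1 * x * (8 * M * (64 * D * E) + A₁ * x ^ (-ν)) := by
        have hin : 0 ≤ 8 * M * ∑ ψ, S ψ + (NumberField.classNumber K : ℝ) * J := by
          have hS0 : 0 ≤ ∑ ψ, S ψ := Finset.sum_nonneg fun ψ _ ↦ by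
            rw [hS]; exact Finset.sum_nonneg fun ρ _ ↦ div_nonneg (mul_nonneg (Nat.cast_nonneg _) (Real.rpow_nonneg hx0.le _)) (by positivity)
          have hJ0 : 0 ≤ J := by
            rw [hJ]
            have : 0 ≤ Real.log (T₁ + 5) := Real.log_nonneg (by linarith)
            have ht1 : 0 ≤ tailConst₁ := by linarith
            have : 0 ≤ tailConst₁ * A + tailConst₂ := by positivity
            positivity
          positivity
        refine mul_le_mul (mul_le_mul_of_nonneg_right hεe hx0.le) (add_le_add (mul_le_mul_of_nonneg_left hfin (by positivity)) hjunk) hin (by positivity)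
    _ = Real.exp 1 * (512 * M * D) * x * E + Real.exp 1 * A₁ * x ^ (1 - ν) := by rw [← hxν]; ring
    _ ≤ A₀ * x * E + A₀ * x ^ (1 - ν) := by
        refine add_le_add ?_ ?_
        · rw [hA₀]
          have h0 : 0 ≤ Real.exp 1 * A₁ * (x * E) := by positivity
          nlinarith only [h0]
        · refine mul_le_mul_of_nonneg_right ?_ (Real.rpow_nonneg hx0.le _)
          rw [hA₀]
          have : 0 ≤ Real.exp 1 * (512 * M * D) := by positivity
          nlinarith only [this]

end Literature.NumberTheory.LFunctions.NumberField

end
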